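import Literature.AlgebraicGeometry.HodgeTheory.VHSDataLocallyChartedLift
import HarnessLib

/-!
# Cattani–Deligne–Kaplan's Theorem 1.1 (`r = 1`), the FINITENESS half: over a punctured compact curve `S^{(K)} → S` has FINITE fibres of
# UNIFORMLY BOUNDED cardinality — at every point there are at most `N(K)` integral Hodge classes of self-intersection `≤ K`

Topic `Literature/AlgebraicGeometry/HodgeTheory` (namespace `Literature.AlgebraicGeometry.Motives.VHSData[.InteriorChart ∕ .PunctureChart ∕
.IsLocallyCharted ∕ .IsCharted]`), lane `lit-hodgefound` (seat `p08`, rows g59-#11, g59-#18 (§4)); companion of `VHSDataLocallyChartedLift` §6 (the ALGEBRAICITY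
half of Theorem 1.1 for locally charted variations: each Hodge locus of bounded norm is all of the curve or finite).  THEOREMS ONLY — no definition,
no named fact, no instance (D-0026 net debt `0`).

PRINTED SOURCE, VERBATIM.  E. Cattani, P. Deligne, A. Kaplan, *On the locus of Hodge classes*, J. AMS 8 (1995) (held text `paper:arxiv-alg-geom_9402009`),
§1 (p. 484): «Fix an integer `K` and let `S^{(K)}` be the space of pairs `(s,u)` with `s ∈ S`, `u ∈ 𝒱_s` integral of type `(0,0)`, and `Q(u,u) ≤ K`.
It projects to `S` and arguments as above show that, locally on `S`, `S^{(K)}` is a finite disjoint sum of closed analytic subspaces. Our main result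
is: **Theorem 1.1.** `S^{(K)}` is an algebraic variety, finite over `S`.»; «**Theorem 1.5.** … there is a neighborhood `U` of `0` in `D^{r+m}` such
that, above `U`, `S^{(K)}` is a finite disjoint sum of traces on `S ∩ U` of closed analytic subspaces of `U`.» (p. 485); Thm. 2.5 (p. 488).

THE STATEMENT FORMALISED (the set-theoretic content of «finite over `S`»: finite fibres of bounded size; the tree already has the closedness of
the images `hodgeLocusOfNormLe` and their algebraicity).  For `D : VHSData S k` LOCALLY CHARTED by coordinate discs `ψ a` covering `S` and FINITELY
MANY ends `σ i` with a compact core off the ends (`VHSData.IsLocallyCharted`; no flatness, no connectedness, no openness of the ends needed), `p + p = k`, `K : ℤ`: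
**there is `N` such that for EVERY `s ∈ S` the set `{u ∈ V_ℤ,s | u of type (p,p), Q(u,u) ≤ K}` — the fibre of `S^{(K)}` over `s` — is FINITE with
AT MOST `N` elements** (§2), over a punctured compact curve (§3), for charted variations and for every tensor space `T^{a,b}D` (§3).

THE ARGUMENT (the printed local finiteness, made uniform by compactness).  INTERIOR (§1): over an interior chart disc the flat values
`e_c(u)` of the integral Hodge classes `u` of norm `≤ K` at the points of the disc form a FINITE set `Υ` (lattice points of bounded Hodge norm for the
comparison `κ‖e_c x‖₀ ≤ ‖x‖_{ρ(c)}`: the tree's `finite_flatValues_isHodgeAt_interior_chart`), and `u ↦ e_c(u)` is injective on each fibre: at most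
`#Υ` classes per point of the disc.  PUNCTURE (§1): beyond the threshold of Thm. 2.5 ∕ 1.5 in a puncture chart, the flat values of the integral Hodge
classes of norm `≤ K` again form a finite set (the tree's `exists_threshold_isHodgeAt_chart`, last clause): at most that many classes per point of the
end.  GLOBAL (§2): the compact core is covered by finitely many chart discs; with finitely many ends, the maximum of the finitely many bounds serves.

* §1 **`InteriorChart.exists_forall_finite_and_ncard_le`**, **`PunctureChart.exists_forall_finite_and_ncard_le`** (chart-level bounds).
* §2 **`IsLocallyCharted.exists_forall_finite_and_ncard_hodgeClassesOfNormLe_le`** — THM 1.1, FINITENESS: a uniform bound on the number of integral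
  Hodge classes of norm `≤ K` per point (compact core, finitely many ends).
* §3 **`…_of_compactification`** (punctured compact curve), **`IsCharted.exists_forall_finite_and_ncard_hodgeClassesOfNormLe_le`**,
  **`IsLocallyCharted.exists_forall_finite_and_ncard_hodgeClassesOfNormLe_tensorSpace_le`** (`T^{a,b}D`).

* §4 (appended, row g59-#18) **`IsLocallyCharted.exists_forall_finite_and_ncard_hodgeDeterminations_le`** — the DETERMINATIONS `γ · u₀` of an
  integral class that are of type `(p,p)` at `t` are at most `N` in number, uniformly in `t` (they have self-intersection `Q(u₀,u₀)`: «for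
  `K = Q(u,u)`»); **`exists_forall_finite_and_ncard_hodgeClassesOfNormLe_le_of_comap`** (a bound for the pull-back `f^*D` along a SURJECTIVE `f`
  is a bound for `D`: the fibres are the same), **`IsLocallyCharted.exists_forall_finite_and_ncard_hodgeClassesOfNormLe_le_of_comap_of_compactification`**
  (charts of `f^*D` on a cover by a punctured compact curve).

HONEST SCOPE: `dim S = 1`; the charts are hypotheses; «finite over `S`» is delivered as finite fibres of uniformly bounded cardinality (plus the
tree's closedness ∕ algebraicity of the images), not as a finite morphism of analytic spaces or schemes.

## References

* [CattaniDeligneKaplan1995] E. Cattani, P. Deligne, A. Kaplan, *On the locus of Hodge classes*, J. Amer. Math. Soc. 8 (1995) 483–506: §1 and Thm. 1.1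
  (p. 484), Thm. 1.5 (p. 485), 2.3, Thm. 2.5 (pp. 487–488).
* [Schmid1973] W. Schmid, *Variation of Hodge structure: the singularities of the period mapping*, Invent. Math. 22 (1973), §2 (cite only).
* [FritzscheGrauert2002] K. Fritzsche, H. Grauert, *From Holomorphic Functions to Complex Manifolds*, GTM 213 (2002), Ch. I §8 (coordinate discs).
* [Deligne1982HodgeCycles] P. Deligne, *Hodge cycles on abelian varieties*, LNM 900 (1982), I §3, 3.1–3.4 (tensor spaces `T^{a,b}`).
-/

noncomputable section

open scoped TensorProduct
open _root_.Topology _root_.Filter Set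

universe u

namespace Literature.AlgebraicGeometry

open Module
open Motives Motives.MixedHodgeStructure Motives.HodgeStructure
open Motives.HodgeStructure (conj ofRat ofRat_apply conj_ofRat)
open HodgeTheory Topology

namespace Motives.VHSData

variable {S : Type} [TopologicalSpace S] {k : ℤ} {D : VHSData S k}
variable {V : Type u} [AddCommGroup V] [Module ℚ V] [FiniteDimensional ℚ V]

/-! ## §1 Chart-level bounds: finitely many integral Hodge classes of bounded norm per point, uniformly over a chart -/

namespace InteriorChart

variable {ψ : OpenPartialHomeomorph S ℂ} {H₀ : HodgeStructure V k} {P₀ : H₀.Polarization}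

/-- **Over an interior chart disc, every point carries at most `N` integral Hodge classes of self-intersection `≤ K`** («locally on `S`, `S^{(K)}` is
a finite disjoint sum of closed analytic subspaces»): the flat values `e_c(u)` of such classes over the disc form a finite set `Υ` (lattice points of
bounded Hodge norm), and `u ↦ e_c(u)` is injective on each fibre, so `N = #Υ` serves — first at the points `ψ⁻¹ c`, `c` in the target.
[cite: CattaniDeligneKaplan1995, §1 (p. 484)] [cite: Schmid1973, §2 (cite only)] -/
theorem exists_forall_finite_and_ncard_le_symm (C : D.InteriorChart ψ P₀) {p : ℤ} (hpk : p + p = k) (K : ℤ) :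
    ∃ N : ℕ, ∀ c ∈ ψ.target,
      {u : D.VZ.fiber (ψ.symm c) | D.IsHodgeAt (ψ.symm c) p u ∧
          (D.form (ψ.symm c)).form (D.toRat (ψ.symm c) u) (D.toRat (ψ.symm c) u) ≤ (K : ℚ)}.Finite ∧
        {u : D.VZ.fiber (ψ.symm c) | D.IsHodgeAt (ψ.symm c) p u ∧
          (D.form (ψ.symm c)).form (D.toRat (ψ.symm c) u) (D.toRat (ψ.symm c) u) ≤ (K : ℚ)}.ncard ≤ N := by
  set Υ : Set V := {v : V | ∃ c ∈ ψ.target, ∃ u : D.VZ.fiber (ψ.symm c), C.e c (D.toRat (ψ.symm c) u) = v ∧ D.IsHodgeAt (ψ.symm c) p u ∧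
      (D.form (ψ.symm c)).form (D.toRat (ψ.symm c) u) (D.toRat (ψ.symm c) u) ≤ (K : ℚ)} with hΥ
  have hΥf : Υ.Finite := D.finite_flatValues_isHodgeAt_interior_chart hpk ψ.symm ψ.target C.e H₀ P₀ C.Λ C.fg_Λ C.e_toRat_mem C.κ_pos
    (fun _ hc x => C.mul_hodgeNorm_ofRat_le hc x) K
  have hm : ∀ c ∈ ψ.target, MapsTo (fun u : D.VZ.fiber (ψ.symm c) => C.e c (D.toRat (ψ.symm c) u))
      {u : D.VZ.fiber (ψ.symm c) | D.IsHodgeAt (ψ.symm c) p u ∧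
        (D.form (ψ.symm c)).form (D.toRat (ψ.symm c) u) (D.toRat (ψ.symm c) u) ≤ (K : ℚ)} Υ :=
    fun c hc u hu => ⟨c, hc, u, rfl, hu.1, hu.2⟩
  have hi : ∀ c : ℂ, InjOn (fun u : D.VZ.fiber (ψ.symm c) => C.e c (D.toRat (ψ.symm c) u))
      {u : D.VZ.fiber (ψ.symm c) | D.IsHodgeAt (ψ.symm c) p u ∧
        (D.form (ψ.symm c)).form (D.toRat (ψ.symm c) u) (D.toRat (ψ.symm c) u) ≤ (K : ℚ)} :=
    fun c u _ v _ huv => D.toRat_injective_holds (ψ.symm c) ((C.e c).injective huv)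
  exact ⟨Υ.ncard, fun c hc => ⟨Set.Finite.of_injOn (hm c hc) (hi c) hΥf, Set.ncard_le_ncard_of_injOn _ (hm c hc) (hi c) hΥf⟩⟩

/-- **Over an interior chart disc, every point carries at most `N` integral Hodge classes of self-intersection `≤ K`** (at the points of the
source of `ψ`). [cite: CattaniDeligneKaplan1995, §1 (p. 484)] [cite: FritzscheGrauert2002, Ch. I §8] -/
theorem exists_forall_finite_and_ncard_le (C : D.InteriorChart ψ P₀) {p : ℤ} (hpk : p + p = k) (K : ℤ) :
    ∃ N : ℕ, ∀ y ∈ ψ.source,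
      {u : D.VZ.fiber y | D.IsHodgeAt y p u ∧ (D.form y).form (D.toRat y u) (D.toRat y u) ≤ (K : ℚ)}.Finite ∧
        {u : D.VZ.fiber y | D.IsHodgeAt y p u ∧ (D.form y).form (D.toRat y u) (D.toRat y u) ≤ (K : ℚ)}.ncard ≤ N := by
  obtain ⟨N, hN⟩ := C.exists_forall_finite_and_ncard_le_symm hpk K
  refine ⟨N, fun y hy => ?_⟩
  have h := hN (ψ y) (ψ.map_source hy)
  rwa [ψ.left_inv hy] at h

end InteriorChart

namespace PunctureChart

variable {σ : ℂ → S} {L : PolarizedLimitMixedHodgeStructure V k}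

/-- **Along the end of a puncture chart (unipotent monodromy), beyond some height every point carries at most `N` integral Hodge classes of
self-intersection `≤ K`** («above `U`, `S^{(K)}` is a finite disjoint sum of traces … of closed analytic subspaces»): beyond the threshold of Thm. 2.5 ∕
1.5 in the chart the flat values of such classes form a finite set (the tree's `exists_threshold_isHodgeAt_chart`), and `u ↦ e_z(u)` is injective on
each fibre. [cite: CattaniDeligneKaplan1995, Thm. 1.5 (p. 485), Thm. 2.5 (p. 488)] [cite: Schmid1973, §2 (cite only)] -/
theorem exists_forall_finite_and_ncard_le (C : D.PunctureChart σ L) {p : ℤ} (hpk : p + p = k) (K : ℤ) :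
    ∃ (A : ℝ) (N : ℕ), C.A₀ ≤ A ∧ ∀ z : ℂ, A ≤ z.im →
      {u : D.VZ.fiber (σ z) | D.IsHodgeAt (σ z) p u ∧ (D.form (σ z)).form (D.toRat (σ z) u) (D.toRat (σ z) u) ≤ (K : ℚ)}.Finite ∧
        {u : D.VZ.fiber (σ z) | D.IsHodgeAt (σ z) p u ∧ (D.form (σ z)).form (D.toRat (σ z) u) (D.toRat (σ z) u) ≤ (K : ℚ)}.ncard ≤ N := by
  obtain ⟨A₁, -, hA₀, -, hfin⟩ := D.exists_threshold_isHodgeAt_chart L hpk C.Γ C.Γ_zero C.analyticAt_Γ C.Γ_mem C.Λ C.fg_Λ C.monodromy_mem σ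
    C.e C.A₀ (fun z hz => C.map_F_eq z hz p) C.form_eq C.e_toRat_mem K
  have hm : ∀ z : ℂ, A₁ ≤ z.im → MapsTo (fun u : D.VZ.fiber (σ z) => C.e z (D.toRat (σ z) u))
      {u : D.VZ.fiber (σ z) | D.IsHodgeAt (σ z) p u ∧ (D.form (σ z)).form (D.toRat (σ z) u) (D.toRat (σ z) u) ≤ (K : ℚ)}
      {v : V | ∃ z : ℂ, A₁ ≤ z.im ∧ ∃ u : D.VZ.fiber (σ z), C.e z (D.toRat (σ z) u) = v ∧
        (D.form (σ z)).form (D.toRat (σ z) u) (D.toRat (σ z) u) ≤ (K : ℚ) ∧ D.IsHodgeAt (σ z) p u} :=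
    fun z hz u hu => ⟨z, hz, u, rfl, hu.2, hu.1⟩
  have hi : ∀ z : ℂ, InjOn (fun u : D.VZ.fiber (σ z) => C.e z (D.toRat (σ z) u))
      {u : D.VZ.fiber (σ z) | D.IsHodgeAt (σ z) p u ∧ (D.form (σ z)).form (D.toRat (σ z) u) (D.toRat (σ z) u) ≤ (K : ℚ)} :=
    fun z u _ v _ huv => D.toRat_injective_holds (σ z) ((C.e z).injective huv)
  exact ⟨A₁, _, hA₀, fun z hz => ⟨Set.Finite.of_injOn (hm z hz) (hi z) hfin, Set.ncard_le_ncard_of_injOn _ (hm z hz) (hi z) hfin⟩⟩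

end PunctureChart

/-! ## §2 Theorem 1.1, finiteness half: a uniform bound on the number of integral Hodge classes of bounded norm per point -/

namespace IsLocallyCharted

variable {α ι : Type*} {ψ : α → OpenPartialHomeomorph S ℂ} {σ : ι → ℂ → S}

/-- **CATTANI–DELIGNE–KAPLAN, THEOREM 1.1 (`r = 1`), FINITENESS HALF: over a locally charted one-dimensional base, `S^{(K)} → S` has FINITE FIBRES of
UNIFORMLY BOUNDED cardinality.**  `D : VHSData S k` locally charted by the coordinate discs `ψ a` (covering `S`) and FINITELY MANY ends `σ i`; along
each end a height `A i` beyond which, off the ends `σᵢ{Im z > A′ i}` (`A′ ≥ A`), a compact core remains; `p + p = k`, `K : ℤ`.  Then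
**there is `N` such that for EVERY `s ∈ S` the set of integral classes `u ∈ V_ℤ,s` of type `(p,p)` with `Q(u,u) ≤ K` is finite with at most `N`
elements** («`S^{(K)}` is an algebraic variety, finite over `S`»: the compact core is covered by finitely many chart discs, each with its bound, and
each of the finitely many ends has its bound). [cite: CattaniDeligneKaplan1995, §1 and Thm. 1.1 (p. 484), Thm. 1.5 (p. 485), Thm. 2.5 (p. 488)]
[cite: Schmid1973, §2 (cite only)] [cite: FritzscheGrauert2002, Ch. I §8] -/
theorem exists_forall_finite_and_ncard_hodgeClassesOfNormLe_le [Finite ι] (h : D.IsLocallyCharted ψ σ) {p : ℤ} (hpk : p + p = k) (K : ℤ)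
    (hcov : ∀ x : S, ∃ a, x ∈ (ψ a).source) (A : ι → ℝ)
    (hcore : ∀ A' : ι → ℝ, (∀ i, A i ≤ A' i) → ∃ K₀ : Set S, IsCompact K₀ ∧ K₀ ∪ ⋃ i, σ i '' {z : ℂ | A' i < z.im} = univ) :
    ∃ N : ℕ, ∀ s : S,
      {u : D.VZ.fiber s | D.IsHodgeAt s p u ∧ (D.form s).form (D.toRat s u) (D.toRat s u) ≤ (K : ℚ)}.Finite ∧
        {u : D.VZ.fiber s | D.IsHodgeAt s p u ∧ (D.form s).form (D.toRat s u) (D.toRat s u) ≤ (K : ℚ)}.ncard ≤ N := by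
  -- local bounds around every point
  have hloc : ∀ x : S, ∃ (U : Set S) (N : ℕ), IsOpen U ∧ x ∈ U ∧ ∀ y ∈ U,
      {u : D.VZ.fiber y | D.IsHodgeAt y p u ∧ (D.form y).form (D.toRat y u) (D.toRat y u) ≤ (K : ℚ)}.Finite ∧
        {u : D.VZ.fiber y | D.IsHodgeAt y p u ∧ (D.form y).form (D.toRat y u) (D.toRat y u) ≤ (K : ℚ)}.ncard ≤ N := fun x => by
    obtain ⟨a, hx⟩ := hcov x
    obtain ⟨r, hr, -, W, _, _, _, H₀, P₀, ⟨C⟩⟩ := h.interior a x hx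
    obtain ⟨N, hN⟩ := C.exists_forall_finite_and_ncard_le hpk K
    exact ⟨(restrBall (ψ a) x r).source, N, (restrBall (ψ a) x r).open_source, mem_restrBall_source_self (ψ a) hx hr, hN⟩
  choose U N hU hxU hN using hloc
  -- bounds along the ends
  have hend : ∀ i, ∃ (A' : ℝ) (N' : ℕ), A i ≤ A' ∧ ∀ z : ℂ, A' < z.im →
      {u : D.VZ.fiber (σ i z) | D.IsHodgeAt (σ i z) p u ∧
          (D.form (σ i z)).form (D.toRat (σ i z) u) (D.toRat (σ i z) u) ≤ (K : ℚ)}.Finite ∧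
        {u : D.VZ.fiber (σ i z) | D.IsHodgeAt (σ i z) p u ∧
          (D.form (σ i z)).form (D.toRat (σ i z) u) (D.toRat (σ i z) u) ≤ (K : ℚ)}.ncard ≤ N' := fun i => by
    obtain ⟨W, _, _, _, L, ⟨C⟩⟩ := h.puncture i
    obtain ⟨A₁, N', -, hN'⟩ := C.exists_forall_finite_and_ncard_le hpk K
    exact ⟨max A₁ (A i), N', le_max_right _ _, fun z hz => hN' z ((le_max_left _ _).trans hz.le)⟩
  choose A' N' hA' hN' using hend
  -- the compact core is covered by finitely many of the `U x`
  obtain ⟨K₀, hK₀, hcovK⟩ := hcore A' hA'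
  obtain ⟨t, ht⟩ := hK₀.elim_finite_subcover U hU fun y _ => mem_iUnion.2 ⟨y, hxU y⟩
  cases nonempty_fintype ι
  refine ⟨max (t.sup N) (Finset.univ.sup N'), fun s => ?_⟩
  have hs : s ∈ K₀ ∪ ⋃ i, σ i '' {z : ℂ | A' i < z.im} := by rw [hcovK]; exact mem_univ s
  rcases hs with hs | hs
  · obtain ⟨x, hx, hsx⟩ := mem_iUnion₂.1 (ht hs)
    exact ⟨(hN x s hsx).1, (hN x s hsx).2.trans ((Finset.le_sup hx).trans (le_max_left _ _))⟩
  · obtain ⟨i, z, hz, rfl⟩ := mem_iUnion.1 hs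
    exact ⟨(hN' i z hz).1, (hN' i z hz).2.trans ((Finset.le_sup (Finset.mem_univ i)).trans (le_max_right _ _))⟩

/-! ## §3 Over a punctured compact curve; charted variations; tensor spaces -/

variable {X : Type*} [TopologicalSpace X] [CompactSpace X]

/-- **THEOREM 1.1, FINITENESS HALF, OVER A PUNCTURED COMPACT CURVE**: the compact core from a compactification `j : S ↪ X` (compact `X`)
with disc charts `φ i` at the finitely many punctures `pt i`, `j (σ i z) = (φ i)⁻¹(e^{2πiz})` for `Im z > A i`.
[cite: CattaniDeligneKaplan1995, Thm. 1.1 (p. 484), «Proof of 1.5 ⟹ 1.1» (p. 485), 2.3 (p. 487)] -/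
theorem exists_forall_finite_and_ncard_hodgeClassesOfNormLe_le_of_compactification [Finite ι] (h : D.IsLocallyCharted ψ σ) {p : ℤ}
    (hpk : p + p = k) (K : ℤ) (hcov : ∀ x : S, ∃ a, x ∈ (ψ a).source) (A : ι → ℝ)
    {j : S → X} (hj : IsEmbedding j) (pt : ι → X) (hpS : ∀ i, pt i ∉ range j) (hcovX : ∀ x : X, x ∉ range j → ∃ i, x = pt i)
    (φ : ι → OpenPartialHomeomorph X ℂ) (hp : ∀ i, pt i ∈ (φ i).source) (hφp : ∀ i, φ i (pt i) = 0)
    (hball : ∀ i, Metric.ball (0 : ℂ) (Real.exp (-(2 * Real.pi * A i))) ⊆ (φ i).target)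
    (hσ : ∀ (i : ι) (z : ℂ), A i < z.im → j (σ i z) = (φ i).symm (Complex.exp (2 * Real.pi * Complex.I * z))) :
    ∃ N : ℕ, ∀ s : S,
      {u : D.VZ.fiber s | D.IsHodgeAt s p u ∧ (D.form s).form (D.toRat s u) (D.toRat s u) ≤ (K : ℚ)}.Finite ∧
        {u : D.VZ.fiber s | D.IsHodgeAt s p u ∧ (D.form s).form (D.toRat s u) (D.toRat s u) ≤ (K : ℚ)}.ncard ≤ N :=
  h.exists_forall_finite_and_ncard_hodgeClassesOfNormLe_le hpk K hcov A
    (Topology.exists_isCompact_core hj pt hpS hcovX φ hp hφp A hball σ hσ)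

/-- **THEOREM 1.1, FINITENESS HALF, FOR EVERY TENSOR SPACE `T^{a,b}D` OF A LOCALLY CHARTED `D`** (the charts of `T^{a,b}D` are those of `D`:
`IsLocallyCharted.tensorSpace`). [cite: CattaniDeligneKaplan1995, §1 and Thm. 1.1 (p. 484)] [cite: Deligne1982HodgeCycles, I §3, 3.1–3.4] -/
theorem exists_forall_finite_and_ncard_hodgeClassesOfNormLe_tensorSpace_le [Finite ι] (h : D.IsLocallyCharted ψ σ) (a b : ℕ) {p : ℤ}
    (hpk : p + p = (a : ℤ) * k + (b : ℤ) * (-k)) (K : ℤ) (hcov : ∀ x : S, ∃ a, x ∈ (ψ a).source) (A : ι → ℝ)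
    (hcore : ∀ A' : ι → ℝ, (∀ i, A i ≤ A' i) → ∃ K₀ : Set S, IsCompact K₀ ∧ K₀ ∪ ⋃ i, σ i '' {z : ℂ | A' i < z.im} = univ) :
    ∃ N : ℕ, ∀ s : S,
      {u : (D.tensorSpace a b).VZ.fiber s | (D.tensorSpace a b).IsHodgeAt s p u ∧
          ((D.tensorSpace a b).form s).form ((D.tensorSpace a b).toRat s u) ((D.tensorSpace a b).toRat s u) ≤ (K : ℚ)}.Finite ∧
        {u : (D.tensorSpace a b).VZ.fiber s | (D.tensorSpace a b).IsHodgeAt s p u ∧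
          ((D.tensorSpace a b).form s).form ((D.tensorSpace a b).toRat s u) ((D.tensorSpace a b).toRat s u) ≤ (K : ℚ)}.ncard ≤ N :=
  (h.tensorSpace a b).exists_forall_finite_and_ncard_hodgeClassesOfNormLe_le hpk K hcov A hcore

end IsLocallyCharted

/-- **THEOREM 1.1, FINITENESS HALF, FOR A CHARTED VARIATION** (`IsCharted ⟹ IsLocallyCharted`). [cite: CattaniDeligneKaplan1995, §1 and Thm. 1.1 (p. 484)] -/
theorem IsCharted.exists_forall_finite_and_ncard_hodgeClassesOfNormLe_le {α ι : Type*} {ψ : α → OpenPartialHomeomorph S ℂ} {σ : ι → ℂ → S}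
    [Finite ι] (h : D.IsCharted ψ σ) {p : ℤ} (hpk : p + p = k) (K : ℤ) (hcov : ∀ x : S, ∃ a, x ∈ (ψ a).source) (A : ι → ℝ)
    (hcore : ∀ A' : ι → ℝ, (∀ i, A i ≤ A' i) → ∃ K₀ : Set S, IsCompact K₀ ∧ K₀ ∪ ⋃ i, σ i '' {z : ℂ | A' i < z.im} = univ) :
    ∃ N : ℕ, ∀ s : S,
      {u : D.VZ.fiber s | D.IsHodgeAt s p u ∧ (D.form s).form (D.toRat s u) (D.toRat s u) ≤ (K : ℚ)}.Finite ∧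
        {u : D.VZ.fiber s | D.IsHodgeAt s p u ∧ (D.form s).form (D.toRat s u) (D.toRat s u) ≤ (K : ℚ)}.ncard ≤ N :=
  h.isLocallyCharted.exists_forall_finite_and_ncard_hodgeClassesOfNormLe_le hpk K hcov A hcore


/-! ## §4 Determinations of one class; descent of the bound from a cover -/

namespace IsLocallyCharted

variable {α ι : Type*} {ψ : α → OpenPartialHomeomorph S ℂ} {σ : ι → ℂ → S}

/-- **The Hodge DETERMINATIONS of an integral class are uniformly finite in number**: for `u₀ ∈ V_ℤ,s₀` there is `N` such that at EVERY `t` the set of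
classes `γ · u₀ ∈ V_ℤ,t` (`γ : s₀ ⇝ t`) of type `(p,p)` is finite with at most `N` elements — every determination has self-intersection `Q(u₀,u₀)`
(«It is a union of images of connected components of `S^{(K)}`, for `K = Q(u,u)`»), so the bound of Theorem 1.1 for `K = ⌈Q(u₀,u₀)⌉` serves.
[cite: CattaniDeligneKaplan1995, Thm. 1.1 and proof of Cor. 1.3 (p. 484)] -/
theorem exists_forall_finite_and_ncard_hodgeDeterminations_le [Finite ι] (h : D.IsLocallyCharted ψ σ) {p : ℤ} (hpk : p + p = k) {s₀ : S}
    (u₀ : D.VZ.fiber s₀) (hcov : ∀ x : S, ∃ a, x ∈ (ψ a).source) (A : ι → ℝ)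
    (hcore : ∀ A' : ι → ℝ, (∀ i, A i ≤ A' i) → ∃ K₀ : Set S, IsCompact K₀ ∧ K₀ ∪ ⋃ i, σ i '' {z : ℂ | A' i < z.im} = univ) :
    ∃ N : ℕ, ∀ t : S,
      {v : D.VZ.fiber t | (∃ γ : Path.Homotopic.Quotient s₀ t, D.VZ.transport γ u₀ = v) ∧ D.IsHodgeAt t p v}.Finite ∧
        {v : D.VZ.fiber t | (∃ γ : Path.Homotopic.Quotient s₀ t, D.VZ.transport γ u₀ = v) ∧ D.IsHodgeAt t p v}.ncard ≤ N := by
  obtain ⟨N, hN⟩ := h.exists_forall_finite_and_ncard_hodgeClassesOfNormLe_le hpk ⌈(D.form s₀).form (D.toRat s₀ u₀) (D.toRat s₀ u₀)⌉ hcov A hcore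
  refine ⟨N, fun t => ?_⟩
  have hsub : {v : D.VZ.fiber t | (∃ γ : Path.Homotopic.Quotient s₀ t, D.VZ.transport γ u₀ = v) ∧ D.IsHodgeAt t p v} ⊆
      {u : D.VZ.fiber t | D.IsHodgeAt t p u ∧
        (D.form t).form (D.toRat t u) (D.toRat t u) ≤ ((⌈(D.form s₀).form (D.toRat s₀ u₀) (D.toRat s₀ u₀)⌉ : ℤ) : ℚ)} := by
    rintro v ⟨⟨γ, rfl⟩, hH⟩
    refine ⟨hH, ?_⟩
    rw [D.form_transport_toRat]
    exact Int.le_ceil _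
  exact ⟨(hN t).1.subset hsub, (Set.ncard_le_ncard hsub (hN t).1).trans (hN t).2⟩

end IsLocallyCharted

variable {S' : Type} [TopologicalSpace S'] {f : C(S', S)}

/-- **A bound for the pull-back is a bound downstairs**: if along a SURJECTIVE `f : S′ → S` every point of `S′` carries at most `N` integral Hodge
classes of `f^*D` of self-intersection `≤ K`, then every point of `S` carries at most `N` such classes of `D` — the fibre of `f^*D` at `s′` IS the fibre
of `D` at `f s′`, with the same Hodge structure and form («one is free to replace `S` by a finite etale covering `S′ → S`»).
[cite: CattaniDeligneKaplan1995, Thm. 1.1 (p. 484) and «Proof of 1.5 ⟹ 1.1» (p. 485)] [cite: Deligne1970, I.1] -/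
theorem exists_forall_finite_and_ncard_hodgeClassesOfNormLe_le_of_comap (hf : Function.Surjective f) {p : ℤ} {K : ℤ}
    (h : ∃ N : ℕ, ∀ s' : S',
      {u : (D.comap f).VZ.fiber s' | (D.comap f).IsHodgeAt s' p u ∧
          ((D.comap f).form s').form ((D.comap f).toRat s' u) ((D.comap f).toRat s' u) ≤ (K : ℚ)}.Finite ∧
        {u : (D.comap f).VZ.fiber s' | (D.comap f).IsHodgeAt s' p u ∧
          ((D.comap f).form s').form ((D.comap f).toRat s' u) ((D.comap f).toRat s' u) ≤ (K : ℚ)}.ncard ≤ N) :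
    ∃ N : ℕ, ∀ s : S,
      {u : D.VZ.fiber s | D.IsHodgeAt s p u ∧ (D.form s).form (D.toRat s u) (D.toRat s u) ≤ (K : ℚ)}.Finite ∧
        {u : D.VZ.fiber s | D.IsHodgeAt s p u ∧ (D.form s).form (D.toRat s u) (D.toRat s u) ≤ (K : ℚ)}.ncard ≤ N := by
  obtain ⟨N, hN⟩ := h
  refine ⟨N, fun s => ?_⟩
  obtain ⟨s', rfl⟩ := hf s
  have h' := hN s'
  simp only [isHodgeAt_comap_iff, comap_toRat, comap_form] at h'
  exact h'

namespace IsLocallyCharted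

variable {α' ι' : Type*} {ψ' : α' → OpenPartialHomeomorph S' ℂ} {σ' : ι' → ℂ → S'}
variable {X : Type*} [TopologicalSpace X] [CompactSpace X]

/-- **THEOREM 1.1, FINITENESS HALF, FROM CHARTS OF THE PULL-BACK TO A COVER BY A PUNCTURED COMPACT CURVE**: `f : S′ → S` surjective, `f^*D` locally
charted by discs covering `S′` and finitely many ends with the compactification of `S′`; then a uniform bound on the number of integral `(p,p)`-classes
with `Q(u,u) ≤ K` per point of `S`. [cite: CattaniDeligneKaplan1995, Thm. 1.1 (p. 484), «Proof of 1.5 ⟹ 1.1» (p. 485), 2.3 (p. 487)] -/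
theorem exists_forall_finite_and_ncard_hodgeClassesOfNormLe_le_of_comap_of_compactification [Finite ι'] (hf : Function.Surjective f)
    (h : (D.comap f).IsLocallyCharted ψ' σ') {p : ℤ} (hpk : p + p = k) (K : ℤ) (hcov : ∀ x' : S', ∃ a, x' ∈ (ψ' a).source) (A : ι' → ℝ)
    {j : S' → X} (hj : IsEmbedding j) (pt : ι' → X) (hpS : ∀ i, pt i ∉ range j) (hcovX : ∀ x : X, x ∉ range j → ∃ i, x = pt i)
    (φ : ι' → OpenPartialHomeomorph X ℂ) (hp : ∀ i, pt i ∈ (φ i).source) (hφp : ∀ i, φ i (pt i) = 0)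
    (hball : ∀ i, Metric.ball (0 : ℂ) (Real.exp (-(2 * Real.pi * A i))) ⊆ (φ i).target)
    (hσ : ∀ (i : ι') (z : ℂ), A i < z.im → j (σ' i z) = (φ i).symm (Complex.exp (2 * Real.pi * Complex.I * z))) :
    ∃ N : ℕ, ∀ s : S,
      {u : D.VZ.fiber s | D.IsHodgeAt s p u ∧ (D.form s).form (D.toRat s u) (D.toRat s u) ≤ (K : ℚ)}.Finite ∧
        {u : D.VZ.fiber s | D.IsHodgeAt s p u ∧ (D.form s).form (D.toRat s u) (D.toRat s u) ≤ (K : ℚ)}.ncard ≤ N :=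
  exists_forall_finite_and_ncard_hodgeClassesOfNormLe_le_of_comap hf
    (h.exists_forall_finite_and_ncard_hodgeClassesOfNormLe_le_of_compactification hpk K hcov A hj pt hpS hcovX φ hp hφp hball hσ)

end IsLocallyCharted

end Motives.VHSData

end Literature.AlgebraicGeometry

end
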